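import Literature.NumberTheory.EllipticCurves.Sprung2017.SharpFlatPAdicLFunctionTwoProofs
import Summits.BirchSwinnertonDyer.BirchSwinnertonDyer.Theorems.ByReductionTypeAtTwoRankOneLogCompatAtTwo
import Summits.BirchSwinnertonDyer.BirchSwinnertonDyer.Theorems.ByReductionTypeAtTwoRankOneSharpFlatEtaDictionaryAtTwo
import Summits.BirchSwinnertonDyer.BirchSwinnertonDyer.Theorems.ByReductionTypeAtTwoRankOneSharpFlatEtaDictionaryHalvesAtTwo
import HarnessLib

/-!
# Capstone of the ♯/♭ ↔ η dictionary: the -an Kato half 56A-K, the bridge B56 and `log_ω(P₀) ≠ 0` IMPLY the -es Kato half K2-Kss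
# (closed `Prop`-level implication, PROVED); likewise 56A ∧ B56 ∧ non-degeneracy ⟹ K2-Vss and 56A-L ∧ B56 ∧ non-degeneracy ⟹ K2-Lss

Cell `bsd-f1-sign2`, seat `-an` g52 (MEMO-an §56.10), crux `stmt-BirchSwinnertonDyer-23715`; helper file, closes nothing, asserts nothing new.

* `twoAdicKatoBoundEtaRankOneSs_of_perrinRiouKatoHalf` —
  `SprungEtaBridgeAtTwo → PerrinRiouKatoHalfAtTwo → (log_ω(P₀ 0) ≠ 0 for Mordell–Weil bases) → Rank1Residual.F1Sign2.TwoAdicKatoBoundEtaRankOneSs`.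
  The case `PR = 0` is trivial (`Λ_η = 0` by the bridge); otherwise the curve-by-curve dictionary
  (`twoAdicKatoBound_iff_perrinRiouKatoHalf`) applies with `ι := algebraMap ℚ ℚ₂`, the Katz dialect lemma, the Mordell–Weil-basis lemmas
  (`P₀ 0` non-torsion, odd index on the slice), `ϖ ≠ 0` from `Ω⁺_f > 0` (`IsNewform0.plusPeriod_pos_holds`), a Sprung pair from
  `exists_isSprungPair_two`, and the log-symbol compatibility `padicLogOrd_eq_valuation_logOmegaAt`.
  The only non-structural input is the binder `hlog` (`log_ω` of a point of infinite order is non-zero: THEOREM-grade, Silverman AEC IV.6.4 +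
  VII.3 — the first conjunct of the -es print-transfer K2-Tss; not yet a tree theorem, hence a binder, never asserted).
* `twoAdicBSDEtaValRankOneSs_of_perrinRiouShaOrder` — `B56 → 56A → hlog → hPR → K2-Vss`, where `hPR` (`PR ≠ 0` on the slice data) is the
  -an non-degeneracy 55A′ read through Gross–Zagier (`Ш_an ≠ 0`); a binder, never asserted.
* `twoAdicLowerBoundEtaRankOneSs_of_perrinRiouLowerHalf` — `B56 → 56A-L → hlog → hPR → K2-Lss`.
STAFFING CONSEQUENCE (MEMO-an §56.10): closing the -an items 56A-K / 56A / 56A-L (♯/♭ currency: Kato 2004 Thm 12.5 + Sprung 2012 §§4–6 at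
`p = 2`) closes the -es items K2-Kss / K2-Vss / K2-Lss given the arithmetic-free bridge B56.  BSD is not proved by any of this; 23715 is not
closed.  References: [cite: Kato2004, Thm. 12.5] [cite: Sprung2012, §§4–6] [cite: SilvermanAEC2009, IV.6.4, VII.3.1].
-/

set_option linter.unusedSectionVars false

namespace Summit.BirchSwinnertonDyer.BirchSwinnertonDyer.Theorems.PerrinRiouElementAtTwo

open scoped Classical MatrixGroups ModularForm
open CongruenceSubgroup PowerSeries WeierstrassCurve Literature.NumberTheory.EllipticCurves Literature.NumberTheory.EllipticCurves.ModularForms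
  Literature.NumberTheory.EllipticCurves.Sprung2017 Literature.NumberTheory.EllipticCurves.Rank1Residual
  Summit.BirchSwinnertonDyer.Rank1Residual.F1Sign2

/-- Shared unpacking of the -es binders into the -an data: supersingularity `2 ∣ a₂`, `GoodSS`, `ϖ ≠ 0`, `Tam ≠ 0`. [folklore] -/
theorem ssData_of_binders (W : WeierstrassCurve ℚ) [W.IsElliptic] [W.IsGloballyMinimal] {N : ℕ} [NeZero N] {f : CuspForm (Gamma0 N) 2}
    {ϖ : ℚ} (hsl : SliceAtTwo W) (hgood : W.HasGoodReductionAtPrime 2) (hnord : ¬ IsOrdinaryAt W 2) (hf : IsNewformOf W f)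
    (hϖ : (ϖ : ℝ) * W.realPeriodRat = plusPeriod f) :
    GoodSS W 2 ∧ ϖ ≠ 0 ∧ Odd W.torsionOrder ∧ W.tamagawaProduct ≠ 0 := by
  have hss : (2 : ℤ) ∣ W.frobeniusTrace 2 := by
    by_contra h
    exact hnord ((isOrdinaryAt_iff W 2).mpr ⟨hgood, h⟩)
  have hϖ0 : ϖ ≠ 0 := by
    intro hz
    rw [hz, Rat.cast_zero, zero_mul] at hϖ
    exact (IsNewform0.plusPeriod_pos_holds hf.1 hf.coeffField_eq_bot).ne' hϖ.symm
  refine ⟨⟨hgood, hss⟩, hϖ0, hsl.2.2.1, fun h => ?_⟩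
  have hTam := hsl.2.2.2
  rw [h] at hTam
  exact absurd hTam (by decide)

/-- **56A-K ∧ B56 ∧ (`log_ω ≠ 0` on Mordell–Weil bases) ⟹ K2-Kss.**  The -an Kato half delivers the -es Kato half. [folklore] -/
theorem twoAdicKatoBoundEtaRankOneSs_of_perrinRiouKatoHalf (hB : SprungEtaBridgeAtTwo) (hK : PerrinRiouKatoHalfAtTwo)
    (hlog : ∀ (W : WeierstrassCurve ℚ) [W.IsElliptic] [W.IsGloballyMinimal] (P : Fin 1 → W.toAffine.Point),
      IsMordellWeilBasis P → logOmegaAt W 2 (P 0) ≠ 0) :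
    TwoAdicKatoBoundEtaRankOneSs := by
  intro W _ _ hsl hgood hnord hr N _ f hf L hL u v huv P hP hfin ϖ hϖ
  obtain ⟨hGS, hϖ0, hT, hTam0⟩ := ssData_of_binders W hsl hgood hnord hf hϖ
  obtain ⟨Ls, Lf, hpair⟩ := exists_isSprungPair_two hf hgood hGS.2
  have hbr := hB f W Ls Lf L u v hGS hr hf hpair hL huv
  by_cases hPR : prComb (W.frobeniusTrace 2) Ls Lf = 0
  · have hΛ : ssLeadingEta W 2 L v = 0 := by
      have h0 : ‖ssLeadingEta W 2 L v‖ = 0 := by rw [hbr, hPR, norm_zero, mul_zero]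
      exact norm_eq_zero.mp h0
    rw [hΛ, mul_zero, zero_mul, norm_zero]
    exact norm_nonneg _
  · have hkz := isKatzColumnAtTwo_of_isKatzFrobeniusColumn W huv
    have hnt := not_isOfFinAddOrder_zero_of_isMordellWeilBasis hP
    have hodd := odd_index_zmultiples_of_isMordellWeilBasis hP hT
    have hdec : (fun a b : ℚ => Classical.propDecidable (a = b)) = instDecidableEqRat := Subsingleton.elim _ _
    rw [hdec] at hnt hodd
    have hlg := hlog W P hP
    have hℓ := padicLogOrd_eq_valuation_logOmegaAt W (algebraMap ℚ ℚ_[2]) (P 0) hlg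
    have h56 := hK f W Ls Lf ϖ (algebraMap ℚ ℚ_[2]) (P 0) u v hGS hr hf hϖ hpair hkz hnt hodd hϖ0 hfin
    exact (twoAdicKatoBound_iff_perrinRiouKatoHalf W (algebraMap ℚ ℚ_[2]) (P 0) hbr hPR hϖ0 hT hTam0 hfin hlg hℓ).mpr h56

/-- **56A ∧ B56 ∧ (`log_ω ≠ 0`) ∧ (`PR ≠ 0` on the slice data) ⟹ K2-Vss.** [folklore] -/
theorem twoAdicBSDEtaValRankOneSs_of_perrinRiouShaOrder (hB : SprungEtaBridgeAtTwo) (h56 : PerrinRiouShaOrderAtTwo)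
    (hlog : ∀ (W : WeierstrassCurve ℚ) [W.IsElliptic] [W.IsGloballyMinimal] (P : Fin 1 → W.toAffine.Point),
      IsMordellWeilBasis P → logOmegaAt W 2 (P 0) ≠ 0)
    (hPRnd : ∀ {N : ℕ} [NeZero N] (f : CuspForm (Gamma0 N) 2) (W : WeierstrassCurve ℚ) [W.IsElliptic] [W.IsGloballyMinimal]
      (Lsharp Lflat : IwasawaAlgebra 2), SliceAtTwo W → GoodSS W 2 → W.analyticRank = 1 → IsNewformOf W f →
      IsSprungPair f 2 (W.frobeniusTrace 2) Lsharp Lflat → prComb (W.frobeniusTrace 2) Lsharp Lflat ≠ 0) :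
    TwoAdicBSDEtaValRankOneSs := by
  intro W _ _ hsl hgood hnord hr N _ f hf L hL u v huv P hP hfin ϖ hϖ
  obtain ⟨hGS, hϖ0, hT, hTam0⟩ := ssData_of_binders W hsl hgood hnord hf hϖ
  obtain ⟨Ls, Lf, hpair⟩ := exists_isSprungPair_two hf hgood hGS.2
  have hbr := hB f W Ls Lf L u v hGS hr hf hpair hL huv
  have hPR := hPRnd f W Ls Lf hsl hGS hr hf hpair
  have hkz := isKatzColumnAtTwo_of_isKatzFrobeniusColumn W huv
  have hnt := not_isOfFinAddOrder_zero_of_isMordellWeilBasis hP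
  have hodd := odd_index_zmultiples_of_isMordellWeilBasis hP hT
  have hdec : (fun a b : ℚ => Classical.propDecidable (a = b)) = instDecidableEqRat := Subsingleton.elim _ _
  rw [hdec] at hnt hodd
  have hlg := hlog W P hP
  have hℓ := padicLogOrd_eq_valuation_logOmegaAt W (algebraMap ℚ ℚ_[2]) (P 0) hlg
  have hid := h56 f W Ls Lf ϖ (algebraMap ℚ ℚ_[2]) (P 0) u v hGS hr hf hϖ hpair hkz hnt hodd hϖ0 hfin
  exact (twoAdicEtaVal_iff_perrinRiouShaOrder W (algebraMap ℚ ℚ_[2]) (P 0) hbr hPR hϖ0 hT hTam0 hfin hlg hℓ).mpr hid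

/-- **56A-L ∧ B56 ∧ (`log_ω ≠ 0`) ∧ (`PR ≠ 0` on the slice data) ⟹ K2-Lss.** [folklore] -/
theorem twoAdicLowerBoundEtaRankOneSs_of_perrinRiouLowerHalf (hB : SprungEtaBridgeAtTwo) (hL56 : PerrinRiouLowerHalfAtTwo)
    (hlog : ∀ (W : WeierstrassCurve ℚ) [W.IsElliptic] [W.IsGloballyMinimal] (P : Fin 1 → W.toAffine.Point),
      IsMordellWeilBasis P → logOmegaAt W 2 (P 0) ≠ 0)
    (hPRnd : ∀ {N : ℕ} [NeZero N] (f : CuspForm (Gamma0 N) 2) (W : WeierstrassCurve ℚ) [W.IsElliptic] [W.IsGloballyMinimal]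
      (Lsharp Lflat : IwasawaAlgebra 2), SliceAtTwo W → GoodSS W 2 → W.analyticRank = 1 → IsNewformOf W f →
      IsSprungPair f 2 (W.frobeniusTrace 2) Lsharp Lflat → prComb (W.frobeniusTrace 2) Lsharp Lflat ≠ 0) :
    TwoAdicLowerBoundEtaRankOneSs := by
  intro W _ _ hsl hgood hnord hr N _ f hf L hL u v huv P hP hfin ϖ hϖ
  obtain ⟨hGS, hϖ0, hT, hTam0⟩ := ssData_of_binders W hsl hgood hnord hf hϖ
  obtain ⟨Ls, Lf, hpair⟩ := exists_isSprungPair_two hf hgood hGS.2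
  have hbr := hB f W Ls Lf L u v hGS hr hf hpair hL huv
  have hPR := hPRnd f W Ls Lf hsl hGS hr hf hpair
  have hkz := isKatzColumnAtTwo_of_isKatzFrobeniusColumn W huv
  have hnt := not_isOfFinAddOrder_zero_of_isMordellWeilBasis hP
  have hodd := odd_index_zmultiples_of_isMordellWeilBasis hP hT
  have hdec : (fun a b : ℚ => Classical.propDecidable (a = b)) = instDecidableEqRat := Subsingleton.elim _ _
  rw [hdec] at hnt hodd
  have hlg := hlog W P hP
  have hℓ := padicLogOrd_eq_valuation_logOmegaAt W (algebraMap ℚ ℚ_[2]) (P 0) hlg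
  have hid := hL56 f W Ls Lf ϖ (algebraMap ℚ ℚ_[2]) (P 0) u v hGS hr hf hϖ hpair hkz hnt hodd hϖ0 hfin
  exact (twoAdicLowerBound_iff_perrinRiouLowerHalf W (algebraMap ℚ ℚ_[2]) (P 0) hbr hPR hϖ0 hT hTam0 hfin hlg hℓ).mpr hid

end Summit.BirchSwinnertonDyer.BirchSwinnertonDyer.Theorems.PerrinRiouElementAtTwo
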